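import Summits.HodgeConjecture.HodgeConjecture.Theorems.PadicSemiregularLiftHodgeAbelianVarietiesCMPivotBridge
import Summits.HodgeConjecture.HodgeConjecture.Theorems.PadicSemiregularLiftHodgeAbelianVarietiesCMPivotSplit
import Summits.HodgeConjecture.HodgeConjecture.Theses.SupersingularIsotypicLift
import Summits.HodgeConjecture.HodgeConjecture.Theses.RankFourFaces

/-!
# Crux `HodgeAbelianVarieties` (stmt-HodgeConjecture-1333), line `cm-pivot` — the CM-typing BRIDGE, item side: the CM pivot over the EXISTING items `CMAbelianHodge` (stmt-3052) and `CMToAbelian` (stmt-16267)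

Route `PadicSemiregularLift`, crux r4 `HodgeAbelianVarieties := ∀ A : AbelianVariety ℂ, HodgeConjectureFor A.dim A.X`.
The CM pivot (glue `hodgeAbelianVarieties_of_cmPivot`, file `…CMPivotSplit`) reads
`HodgeAbelianVarieties ⇐ HodgeCM[] ∧ CMAnchoredFamilies[] ∧ LocalVHCAtCM[]` with `HodgeCM[]` = HC for abelian
varieties carrying an endomorphism with `2 · dim A` distinct eigenvalues on `H¹` (`IsCM[A]`). The tree already
has, as typed ITEMS of other routes,

* `CMAbelianHodge` (stmt-HodgeConjecture-3052; `Theses.SupersingularIsotypicLift` and, byte-identically,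
  `Theses.RankFourFaces`): HC for every complex abelian variety whose `End⁰(A) = ℚ ⊗ End A` contains a
  commutative reduced `ℚ`-subalgebra of dimension `2 · dim A`;
* `CMToAbelian` (stmt-HodgeConjecture-16267; `Theses.RankFourFaces`): `CMAbelianHodge →` HC for every complex
  abelian variety.

With the bridge core `cmSubalgebra_of_isCM` (file `…CMPivotBridge`: `IsCM[A]` ⟹ the CM hypothesis of
`CMAbelianHodge`, PROVED) this file proves (all sorry-free, registered sub-goals of the crux item):

* `hodgeCM_of_cmAbelianHodge` — **stmt-3052 ⟹ child 1** (`CMAbelianHodge → HodgeCM[]`);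
* `hodgeAbelianVarieties_of_cmAbelianHodge_of_cmAnchoredFamilies_of_localVHCAtCM` — **the CM pivot with child 1
  replaced by the existing item**: `CMAbelianHodge → CMAnchoredFamilies[] → LocalVHCAtCM[] → HodgeAbelianVarieties`
  (the gen-2 composition of the line's skeleton);
* `cmToAbelian_of_cmAnchoredFamilies_of_localVHCAtCM` — **children 2 ∧ 3 ⟹ stmt-16267**
  (`CMAnchoredFamilies[] → LocalVHCAtCM[] → RankFourFaces.CMToAbelian`);
* `hodgeAbelianVarieties_of_cmAbelianHodge_of_cmToAbelian` — **the crux is implied by the two existing items**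
  (`RankFourFaces.CMAbelianHodge → RankFourFaces.CMToAbelian → HodgeAbelianVarieties`; smooth projectivity of
  abelian varieties is the theorem `AbelianVariety.isSmoothProjective_holds`);
* `rankFourFaces_cmAbelianHodge_iff` — the two copies of `CMAbelianHodge` are the same statement.

So, for the planner: the honest decomposition of this crux into EXISTING items is
`HodgeAbelianVarieties ⇐ stmt-3052 ∧ stmt-16267`, and the line `cm-pivot` refines stmt-16267's content into
`CMAnchoredFamilies[]` (print: moduli + CDK + CM points; reduced to `NonCMSections[]`/`HodgeLocusCMSection[]`,
file `…CMPivotStubCmAnchoredFamilies`) and `LocalVHCAtCM[]` (open; localised to the deep middle `m ≥ 4`,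
`2 ≤ p ≤ m - 2` given abelian fibres, file `…CMPivotStubLocalVHCAtCM`).
-/

set_option linter.dupNamespace false

noncomputable section

open CategoryTheory
open Literature.AlgebraicGeometry Literature.AlgebraicGeometry.Motives

namespace Summit.HodgeConjecture.HodgeConjecture.Theorems.HodgeAbelianVarieties.CMPivot

/-! ### The three sub-crux statements (verbatim the children to be installed in the route file) -/

/-- `IsCM[A]` — CM type: an endomorphism with `2 · dim A` distinct eigenvalues on `H¹(A(ℂ); ℂ)`
(verbatim the gallery line's notation). Local notation only. -/
local notation3 (prettyPrint := false) "IsCM[" A "]" =>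
  ∃ (ψ : A ⟶ A) (μ : Fin (2 * AbelianVariety.dim A) → ℂ), Function.Injective μ ∧
    ∀ i, Module.End.HasEigenvalue (HodgeTheory.complexBetti.map ψ.hom.hom.hom 1).hom (μ i)

/-- `QProj[X]` — `X` is quasi-projective over `ℂ`: INLINED body of
`HodgeTheory.IsQuasiProjectiveOver X` (the route file does not import its home module). Local notation only. -/
local notation3 (prettyPrint := false) "QProj[" X "]" =>
  ∃ (P : SchemeOver ℂ) (j : X ⟶ P), IsProjectiveOver P ∧ AlgebraicGeometry.IsOpenImmersion j.left

/-- `FibreIncl[f, B, e, s]` — `e` presents `B` as THE fibre of `f` over `s` (`≫` spelled out). Local notation only. -/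
local notation3 (prettyPrint := false) "FibreIncl[" f ", " B ", " e ", " s "]" =>
  ∃ i : AbelianVariety.X B ≅ fiberOver f s, e = CategoryStruct.comp i.hom (fiberι f s)

/-- `HodgeAlong[S, 𝒳, f, G, p]` — `G` is rational `(p,p)` on every fibre presented as an abelian variety. Local notation only. -/
local notation3 (prettyPrint := false) "HodgeAlong[" S ", " 𝒳 ", " f ", " G ", " p "]" =>
  ∀ (B : AbelianVariety ℂ) (eB : AbelianVariety.X B ⟶ 𝒳) (u : ComplexPoints S),
    FibreIncl[f, B, eB, u] →
      HodgeTheory.IsRationalClass (HodgeTheory.complexBetti.map eB (2 * p) G) ∧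
      HodgeTheory.IsOfHodgeType B.dim B.X (2 * p) p p (HodgeTheory.complexBetti.map eB (2 * p) G)

/-- CHILD 1 `HodgeCM[]` — the Hodge conjecture for complex abelian varieties of CM type. Local notation only. -/
local notation3 (prettyPrint := false) "HodgeCM[]" =>
  ∀ A : AbelianVariety ℂ, IsCM[A] → HodgeTheory.HodgeConjectureFor A.dim A.X

/-- CHILD 2 `CMAnchoredFamilies[]` — CM-anchored Mumford–Tate packaging of every rational `(p,p)` class
(the gallery line's `CMFamilies[]` clause (b), gen 3, with the total space quasi-projective; clause (a)
"Hodge models exist" dropped, being the theorem `Stubs.cmFamilies_nonempty_hodgeModel`). Local notation only. -/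
local notation3 (prettyPrint := false) "CMAnchoredFamilies[]" =>
  ∀ (A : AbelianVariety ℂ) (p : ℕ) (c : HodgeTheory.complexBetti A.X (2 * p)),
    HodgeTheory.IsRationalClass c → HodgeTheory.IsOfHodgeType A.dim A.X (2 * p) p p c →
    ∃ (S 𝒳 : SchemeOver ℂ) (f : 𝒳 ⟶ S) (G : HodgeTheory.complexBetti 𝒳 (2 * p))
      (t s₀ : ComplexPoints S) (e : A.X ⟶ 𝒳) (A₀ : AbelianVariety ℂ) (e₀ : A₀.X ⟶ 𝒳),
      QProj[𝒳] ∧ QProj[S] ∧ AlgebraicGeometry.Smooth S.hom ∧ IrreducibleSpace S.left ∧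
      IsSmoothProjectiveFamily f A.dim ∧
      FibreIncl[f, A, e, t] ∧ FibreIncl[f, A₀, e₀, s₀] ∧ IsCM[A₀] ∧
      HodgeTheory.complexBetti.map e (2 * p) G = c ∧ HodgeAlong[S, 𝒳, f, G, p]

/-- CHILD 3 `LocalVHCAtCM[]` — local variational Hodge at a CM fibre (= the gallery line's germ
`OpenNearCM[]`, worker file p92924, with `IsQuasiProjectiveOver` inlined). Local notation only. -/
local notation3 (prettyPrint := false) "LocalVHCAtCM[]" =>
  ∀ (S 𝒳 : SchemeOver ℂ) (f : 𝒳 ⟶ S) (m p : ℕ) (G : HodgeTheory.complexBetti 𝒳 (2 * p))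
    (s₀ : ComplexPoints S) (A₀ : AbelianVariety ℂ) (e₀ : A₀.X ⟶ 𝒳),
    QProj[𝒳] → QProj[S] → AlgebraicGeometry.Smooth S.hom → IrreducibleSpace S.left →
    IsSmoothProjectiveFamily f m →
    FibreIncl[f, A₀, e₀, s₀] → IsCM[A₀] →
    HodgeTheory.complexBetti.map e₀ (2 * p) G ∈ HodgeTheory.algebraicClasses A₀.X p →
    HodgeAlong[S, 𝒳, f, G, p] →
    ∃ U : Set (ComplexPoints S), IsOpen U ∧ s₀ ∈ U ∧ ∀ t ∈ U,
      HodgeTheory.complexBetti.map (fiberι f t) (2 * p) G ∈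
        HodgeTheory.algebraicClasses (fiberOver f t) p

/-! ### The bridges -/

/-- **stmt-3052 ⟹ child 1 of the CM pivot**: HC for abelian varieties with a CM subalgebra of `End⁰`
(`SupersingularIsotypicLift.CMAbelianHodge`) implies HC for abelian varieties with an endomorphism having
`2 · dim A` distinct eigenvalues on `H¹` (`HodgeCM[]`), by the bridge core `cmSubalgebra_of_isCM` and
`AbelianVariety.isSmoothProjective_holds`. [cite: MumfordAV1970, §19 Thm. 3 Cor. and §22] -/
theorem hodgeCM_of_cmAbelianHodge :
    Summit.HodgeConjecture.HodgeConjecture.Theses.SupersingularIsotypicLift.CMAbelianHodge → HodgeCM[] :=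
  fun h A hA => h A (AbelianVariety.isSmoothProjective_holds (A := A)) (cmSubalgebra_of_isCM A hA)

/-- **The CM pivot over the existing item stmt-3052** (gen-2 composition of the line `cm-pivot`):
`CMAbelianHodge ∧ CMAnchoredFamilies ∧ LocalVHCAtCM ⟹ HodgeAbelianVarieties`. [folklore assembly]
[cite: BlochEsnaultKerz2014CharZero, appendix] -/
theorem hodgeAbelianVarieties_of_cmAbelianHodge_of_cmAnchoredFamilies_of_localVHCAtCM :
    Summit.HodgeConjecture.HodgeConjecture.Theses.SupersingularIsotypicLift.CMAbelianHodge →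
      CMAnchoredFamilies[] → LocalVHCAtCM[] →
        Summit.HodgeConjecture.HodgeConjecture.Theses.PadicSemiregularLift.HodgeAbelianVarieties :=
  fun h₁ h₂ h₃ => hodgeAbelianVarieties_of_cmPivot (hodgeCM_of_cmAbelianHodge h₁) h₂ h₃

/-- **Children 2 ∧ 3 of the CM pivot ⟹ the existing item stmt-16267** (`RankFourFaces.CMToAbelian`:
HC for CM abelian varieties implies HC for all complex abelian varieties): the transport half of the crux,
in the items' typing. [cite: Deligne1982HodgeCycles] [cite: BlochEsnaultKerz2014CharZero, appendix] -/
theorem cmToAbelian_of_cmAnchoredFamilies_of_localVHCAtCM :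
    CMAnchoredFamilies[] → LocalVHCAtCM[] →
      Summit.HodgeConjecture.HodgeConjecture.Theses.RankFourFaces.CMToAbelian :=
  fun h₂ h₃ h₁ A _ => hodgeAbelianVarieties_of_cmPivot (hodgeCM_of_cmAbelianHodge h₁) h₂ h₃ A

/-- **The crux from the two existing items** stmt-3052 (`CMAbelianHodge`) and stmt-16267 (`CMToAbelian`):
abelian varieties are smooth projective (`AbelianVariety.isSmoothProjective_holds`). [folklore] -/
theorem hodgeAbelianVarieties_of_cmAbelianHodge_of_cmToAbelian :
    Summit.HodgeConjecture.HodgeConjecture.Theses.RankFourFaces.CMAbelianHodge →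
      Summit.HodgeConjecture.HodgeConjecture.Theses.RankFourFaces.CMToAbelian →
        Summit.HodgeConjecture.HodgeConjecture.Theses.PadicSemiregularLift.HodgeAbelianVarieties :=
  fun h₁ h₂ A => h₂ h₁ A (AbelianVariety.isSmoothProjective_holds (A := A))

/-- The two route copies of `CMAbelianHodge` (RankFourFaces / SupersingularIsotypicLift) are the same
statement. [folklore] -/
theorem rankFourFaces_cmAbelianHodge_iff :
    Summit.HodgeConjecture.HodgeConjecture.Theses.RankFourFaces.CMAbelianHodge ↔
      Summit.HodgeConjecture.HodgeConjecture.Theses.SupersingularIsotypicLift.CMAbelianHodge :=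
  Iff.rfl

/-- Upper bound: the crux implies stmt-16267 outright (its conclusion is HC for abelian varieties), so the
decomposition `crux ⇐ stmt-3052 ∧ stmt-16267` loses nothing. [folklore] -/
theorem cmToAbelian_of_hodgeAbelianVarieties :
    Summit.HodgeConjecture.HodgeConjecture.Theses.PadicSemiregularLift.HodgeAbelianVarieties →
      Summit.HodgeConjecture.HodgeConjecture.Theses.RankFourFaces.CMToAbelian :=
  fun h _ A _ => h A

end Summit.HodgeConjecture.HodgeConjecture.Theorems.HodgeAbelianVarieties.CMPivot

end
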